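import Summits.BirchSwinnertonDyer.BirchSwinnertonDyer.Theorems.ClassRecordThreeReg3CertModelsDefs
import Summits.BirchSwinnertonDyer.BirchSwinnertonDyer.Theorems.ClassRecordThreeRegCertRows34
import Summits.BirchSwinnertonDyer.BirchSwinnertonDyer.Theorems.ClassRecordThreeRegCertRows35
import Summits.BirchSwinnertonDyer.BirchSwinnertonDyer.Theorems.ClassRecordThreeRegCertRows36
import Summits.BirchSwinnertonDyer.BirchSwinnertonDyer.Theorems.ClassRecordThreeRegCertRows37
import Summits.BirchSwinnertonDyer.BirchSwinnertonDyer.Theorems.ClassRecordThreeRegCertRows38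
import Summits.BirchSwinnertonDyer.BirchSwinnertonDyer.Theorems.ClassRecordThreeRegCertRows39
import Summits.BirchSwinnertonDyer.BirchSwinnertonDyer.Theorems.ClassRecordThreeRegCertRows40
import Summits.BirchSwinnertonDyer.BirchSwinnertonDyer.Theorems.ClassRecordThreeRegCertRows41
import Summits.BirchSwinnertonDyer.BirchSwinnertonDyer.Theorems.ClassRecordThreeRegCertRows42
import Summits.BirchSwinnertonDyer.BirchSwinnertonDyer.Theorems.ClassRecordThreeRegCertRows43
import Summits.BirchSwinnertonDyer.BirchSwinnertonDyer.Theorems.ClassRecordThreeRegCertRows44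
import Summits.BirchSwinnertonDyer.BirchSwinnertonDyer.Theorems.ClassRecordThreeRegCertRows45
import Summits.BirchSwinnertonDyer.BirchSwinnertonDyer.Theorems.ClassRecordThreeRegCertRows46
import Summits.BirchSwinnertonDyer.BirchSwinnertonDyer.Theorems.ClassRecordThreeRegCertRows47
import Summits.BirchSwinnertonDyer.BirchSwinnertonDyer.Theorems.ClassRecordThreeRegCertRows48
import Summits.BirchSwinnertonDyer.BirchSwinnertonDyer.Theorems.ClassRecordThreeRegCertRows49
import Summits.BirchSwinnertonDyer.BirchSwinnertonDyer.Theorems.ClassRecordThreeRegCertRows50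
import Summits.BirchSwinnertonDyer.BirchSwinnertonDyer.Theorems.ClassRecordThreeRegCertRows51
import Summits.BirchSwinnertonDyer.BirchSwinnertonDyer.Theorems.ClassRecordThreeRegCertRows52
import Summits.BirchSwinnertonDyer.BirchSwinnertonDyer.Theorems.ClassRecordThreeRegCertRows56
import Summits.BirchSwinnertonDyer.BirchSwinnertonDyer.Theorems.ClassRecordThreeRegCertRows57
import Summits.BirchSwinnertonDyer.BirchSwinnertonDyer.Theorems.ClassRecordThreeRegCertRows58
import Summits.BirchSwinnertonDyer.BirchSwinnertonDyer.Theorems.ClassRecordThreeRegCertRows59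
import Summits.BirchSwinnertonDyer.BirchSwinnertonDyer.Theorems.ClassRecordThreeRegCertRows60
import Summits.BirchSwinnertonDyer.BirchSwinnertonDyer.Theorems.ClassRecordThreeRegCertRows61
import Summits.BirchSwinnertonDyer.BirchSwinnertonDyer.Theorems.ClassRecordThreeRegCertRows62
import Summits.BirchSwinnertonDyer.BirchSwinnertonDyer.Theorems.ClassRecordThreeRegCertRows63
import Summits.BirchSwinnertonDyer.BirchSwinnertonDyer.Theorems.ClassRecordThreeRegCertRows64
import HarnessLib

/-!
# Route `ClassRecordThree`, crux `SchneiderAtThree` (item 19106): the REG3CERT finite-table consumer, chunk 3 ∕ 4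
# (cell `bsd-stepL`, seat `bsd-stepL-reg3-eng` g5; `--supports stmt-BirchSwinnertonDyer-19106`)

HONEST FRAMING: BSD is not proved by any of this; nothing here closes the crux; Schneider's non-degeneracy conjecture
(barrier `PAdicHeightNondegeneracy`) is asserted NOWHERE; the theorem below is a FINITE conjunction of per-curve rung
theorems, one for each of the 181 models of `Reg3Cert.reg3certModels₃` (Cremona `219120v1` … `427056a1`), each of
which was already a kernel theorem modulo GZK (`Rows.rung_<label>` in `Theorems/ClassRecordThreeRegCertRows*.lean`). The proof walks the
list literal: `W ∈ a :: l ↔ W = a ∨ W ∈ l`, one row theorem per head. Theorems only (0 defs, 0 facts).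
References: [SteinWuthrich2013] §4.2 and Conj. 4.1; [KolyvaginEulerSystems1990] Thm. A (GZK).
-/

open WeierstrassCurve Literature.NumberTheory.EllipticCurves
  Literature.NumberTheory.EllipticCurves.Rank1Residual
  Summit.BirchSwinnertonDyer.Rank1Residual
  Summit.BirchSwinnertonDyer.Rank1Residual.X11b
  Summit.BirchSwinnertonDyer.Rank1Residual.X11b.RegMult

namespace Summit.BirchSwinnertonDyer.Rank1Residual.X11b.RegMult.Reg3Cert

/-- **REG3CERT rungs, chunk 3 ∕ 4.** For every globally minimal `W` among the 181 models of
`reg3certModels₃` (Cremona `219120v1` … `427056a1`): from the PUBLISHED fact GZK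
(`rank_eq_analyticRank_of_analyticRank_le_one`), `ClassX11b W 3 → Ram W 3 → ¬ split(3) →
ClassClosure.RegulatorNonvanishingAt W 3` — the matrix of crux `SchneiderAtThree` at that curve, by the row's kernel
certificate. A finite conjunction of ONE-curve theorems; nothing class-wide; closes nothing by itself.
[cite: SteinWuthrich2013, §4.2 and Conj. 4.1] [cite: KolyvaginEulerSystems1990, Thm. A] -/
theorem rung_of_mem_reg3certModels₃ (hGZK : rank_eq_analyticRank_of_analyticRank_le_one) (W : WeierstrassCurve ℚ)
    [W.IsElliptic] [W.IsGloballyMinimal] (hW : W ∈ reg3certModels₃) :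
    ClassX11b W 3 → Ram W 3 → ¬ W.HasSplitMultiplicativeReductionAtPrime 3 →
      ClassClosure.RegulatorNonvanishingAt W 3 := by
  unfold reg3certModels₃ at hW
  refine (List.mem_cons.mp hW).elim (fun h => Rows.rung_219120v1 hGZK W h) fun hW => ?_  -- 219120v1
  refine (List.mem_cons.mp hW).elim (fun h => Rows.rung_346710bh1 hGZK W h) fun hW => ?_  -- 346710bh1
  refine (List.mem_cons.mp hW).elim (fun h => Rows.rung_336630bt1 hGZK W h) fun hW => ?_  -- 336630bt1
  refine (List.mem_cons.mp hW).elim (fun h => Rows.rung_399504c1 hGZK W h) fun hW => ?_  -- 399504c1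
  refine (List.mem_cons.mp hW).elim (fun h => Rows.rung_417144e1 hGZK W h) fun hW => ?_  -- 417144e1
  refine (List.mem_cons.mp hW).elim (fun h => Rows.rung_441840h1 hGZK W h) fun hW => ?_  -- 441840h1
  refine (List.mem_cons.mp hW).elim (fun h => Rows.rung_484410bb1 hGZK W h) fun hW => ?_  -- 484410bb1
  refine (List.mem_cons.mp hW).elim (fun h => Rows.rung_454440d1 hGZK W h) fun hW => ?_  -- 454440d1
  refine (List.mem_cons.mp hW).elim (fun h => Rows.rung_410820d1 hGZK W h) fun hW => ?_  -- 410820d1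
  refine (List.mem_cons.mp hW).elim (fun h => Rows.rung_427614c1 hGZK W h) fun hW => ?_  -- 427614c1
  refine (List.mem_cons.mp hW).elim (fun h => Rows.rung_251220c1 hGZK W h) fun hW => ?_  -- 251220c1
  refine (List.mem_cons.mp hW).elim (fun h => Rows.rung_256542t1 hGZK W h) fun hW => ?_  -- 256542t1
  refine (List.mem_cons.mp hW).elim (fun h => Rows.rung_382902d1 hGZK W h) fun hW => ?_  -- 382902d1
  refine (List.mem_cons.mp hW).elim (fun h => Rows.rung_225960s1 hGZK W h) fun hW => ?_  -- 225960s1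
  refine (List.mem_cons.mp hW).elim (fun h => Rows.rung_457950ca1 hGZK W h) fun hW => ?_  -- 457950ca1
  refine (List.mem_cons.mp hW).elim (fun h => Rows.rung_475536g1 hGZK W h) fun hW => ?_  -- 475536g1
  refine (List.mem_cons.mp hW).elim (fun h => Rows.rung_430050l1 hGZK W h) fun hW => ?_  -- 430050l1
  refine (List.mem_cons.mp hW).elim (fun h => Rows.rung_454890d1 hGZK W h) fun hW => ?_  -- 454890d1
  refine (List.mem_cons.mp hW).elim (fun h => Rows.rung_376635a1 hGZK W h) fun hW => ?_  -- 376635a1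
  refine (List.mem_cons.mp hW).elim (fun h => Rows.rung_422310h1 hGZK W h) fun hW => ?_  -- 422310h1
  refine (List.mem_cons.mp hW).elim (fun h => Rows.rung_441210br1 hGZK W h) fun hW => ?_  -- 441210br1
  refine (List.mem_cons.mp hW).elim (fun h => Rows.rung_399504t1 hGZK W h) fun hW => ?_  -- 399504t1
  refine (List.mem_cons.mp hW).elim (fun h => Rows.rung_402402x1 hGZK W h) fun hW => ?_  -- 402402x1
  refine (List.mem_cons.mp hW).elim (fun h => Rows.rung_364854m1 hGZK W h) fun hW => ?_  -- 364854m1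
  refine (List.mem_cons.mp hW).elim (fun h => Rows.rung_232050bw1 hGZK W h) fun hW => ?_  -- 232050bw1
  refine (List.mem_cons.mp hW).elim (fun h => Rows.rung_363720e1 hGZK W h) fun hW => ?_  -- 363720e1
  refine (List.mem_cons.mp hW).elim (fun h => Rows.rung_481110bc1 hGZK W h) fun hW => ?_  -- 481110bc1
  refine (List.mem_cons.mp hW).elim (fun h => Rows.rung_394350b1 hGZK W h) fun hW => ?_  -- 394350b1
  refine (List.mem_cons.mp hW).elim (fun h => Rows.rung_429450g1 hGZK W h) fun hW => ?_  -- 429450g1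
  refine (List.mem_cons.mp hW).elim (fun h => Rows.rung_449358f1 hGZK W h) fun hW => ?_  -- 449358f1
  refine (List.mem_cons.mp hW).elim (fun h => Rows.rung_307230bk1 hGZK W h) fun hW => ?_  -- 307230bk1
  refine (List.mem_cons.mp hW).elim (fun h => Rows.rung_207480bs1 hGZK W h) fun hW => ?_  -- 207480bs1
  refine (List.mem_cons.mp hW).elim (fun h => Rows.rung_350880q1 hGZK W h) fun hW => ?_  -- 350880q1
  refine (List.mem_cons.mp hW).elim (fun h => Rows.rung_400890bd1 hGZK W h) fun hW => ?_  -- 400890bd1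
  refine (List.mem_cons.mp hW).elim (fun h => Rows.rung_175560cn1 hGZK W h) fun hW => ?_  -- 175560cn1
  refine (List.mem_cons.mp hW).elim (fun h => Rows.rung_307230bv1 hGZK W h) fun hW => ?_  -- 307230bv1
  refine (List.mem_cons.mp hW).elim (fun h => Rows.rung_434112f1 hGZK W h) fun hW => ?_  -- 434112f1
  refine (List.mem_cons.mp hW).elim (fun h => Rows.rung_195888cn1 hGZK W h) fun hW => ?_  -- 195888cn1
  refine (List.mem_cons.mp hW).elim (fun h => Rows.rung_176358v1 hGZK W h) fun hW => ?_  -- 176358v1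
  refine (List.mem_cons.mp hW).elim (fun h => Rows.rung_331170ba1 hGZK W h) fun hW => ?_  -- 331170ba1
  refine (List.mem_cons.mp hW).elim (fun h => Rows.rung_438960e1 hGZK W h) fun hW => ?_  -- 438960e1
  refine (List.mem_cons.mp hW).elim (fun h => Rows.rung_358566h1 hGZK W h) fun hW => ?_  -- 358566h1
  refine (List.mem_cons.mp hW).elim (fun h => Rows.rung_441840bf1 hGZK W h) fun hW => ?_  -- 441840bf1
  refine (List.mem_cons.mp hW).elim (fun h => Rows.rung_446880cj1 hGZK W h) fun hW => ?_  -- 446880cj1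
  refine (List.mem_cons.mp hW).elim (fun h => Rows.rung_482898i1 hGZK W h) fun hW => ?_  -- 482898i1
  refine (List.mem_cons.mp hW).elim (fun h => Rows.rung_88242f1 hGZK W h) fun hW => ?_  -- 88242f1
  refine (List.mem_cons.mp hW).elim (fun h => Rows.rung_212520n1 hGZK W h) fun hW => ?_  -- 212520n1
  refine (List.mem_cons.mp hW).elim (fun h => Rows.rung_381270b1 hGZK W h) fun hW => ?_  -- 381270b1
  refine (List.mem_cons.mp hW).elim (fun h => Rows.rung_68178d1 hGZK W h) fun hW => ?_  -- 68178d1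
  refine (List.mem_cons.mp hW).elim (fun h => Rows.rung_289974b1 hGZK W h) fun hW => ?_  -- 289974b1
  refine (List.mem_cons.mp hW).elim (fun h => Rows.rung_380400bc1 hGZK W h) fun hW => ?_  -- 380400bc1
  refine (List.mem_cons.mp hW).elim (fun h => Rows.rung_465465i1 hGZK W h) fun hW => ?_  -- 465465i1
  refine (List.mem_cons.mp hW).elim (fun h => Rows.rung_265980d1 hGZK W h) fun hW => ?_  -- 265980d1
  refine (List.mem_cons.mp hW).elim (fun h => Rows.rung_489720q1 hGZK W h) fun hW => ?_  -- 489720q1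
  refine (List.mem_cons.mp hW).elim (fun h => Rows.rung_392370b1 hGZK W h) fun hW => ?_  -- 392370b1
  refine (List.mem_cons.mp hW).elim (fun h => Rows.rung_76458a1 hGZK W h) fun hW => ?_  -- 76458a1
  refine (List.mem_cons.mp hW).elim (fun h => Rows.rung_484050bm1 hGZK W h) fun hW => ?_  -- 484050bm1
  refine (List.mem_cons.mp hW).elim (fun h => Rows.rung_499290bk1 hGZK W h) fun hW => ?_  -- 499290bk1
  refine (List.mem_cons.mp hW).elim (fun h => Rows.rung_426972g1 hGZK W h) fun hW => ?_  -- 426972g1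
  refine (List.mem_cons.mp hW).elim (fun h => Rows.rung_441966b1 hGZK W h) fun hW => ?_  -- 441966b1
  refine (List.mem_cons.mp hW).elim (fun h => Rows.rung_102090p1 hGZK W h) fun hW => ?_  -- 102090p1
  refine (List.mem_cons.mp hW).elim (fun h => Rows.rung_335580n1 hGZK W h) fun hW => ?_  -- 335580n1
  refine (List.mem_cons.mp hW).elim (fun h => Rows.rung_366360d1 hGZK W h) fun hW => ?_  -- 366360d1
  refine (List.mem_cons.mp hW).elim (fun h => Rows.rung_241806f1 hGZK W h) fun hW => ?_  -- 241806f1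
  refine (List.mem_cons.mp hW).elim (fun h => Rows.rung_487830bo1 hGZK W h) fun hW => ?_  -- 487830bo1
  refine (List.mem_cons.mp hW).elim (fun h => Rows.rung_208362ck1 hGZK W h) fun hW => ?_  -- 208362ck1
  refine (List.mem_cons.mp hW).elim (fun h => Rows.rung_348285p1 hGZK W h) fun hW => ?_  -- 348285p1
  refine (List.mem_cons.mp hW).elim (fun h => Rows.rung_367770c1 hGZK W h) fun hW => ?_  -- 367770c1
  refine (List.mem_cons.mp hW).elim (fun h => Rows.rung_228228t1 hGZK W h) fun hW => ?_  -- 228228t1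
  refine (List.mem_cons.mp hW).elim (fun h => Rows.rung_406770bl1 hGZK W h) fun hW => ?_  -- 406770bl1
  refine (List.mem_cons.mp hW).elim (fun h => Rows.rung_419475q1 hGZK W h) fun hW => ?_  -- 419475q1
  refine (List.mem_cons.mp hW).elim (fun h => Rows.rung_469650bj1 hGZK W h) fun hW => ?_  -- 469650bj1
  refine (List.mem_cons.mp hW).elim (fun h => Rows.rung_311100e1 hGZK W h) fun hW => ?_  -- 311100e1
  refine (List.mem_cons.mp hW).elim (fun h => Rows.rung_337350t1 hGZK W h) fun hW => ?_  -- 337350t1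
  refine (List.mem_cons.mp hW).elim (fun h => Rows.rung_213486bd1 hGZK W h) fun hW => ?_  -- 213486bd1
  refine (List.mem_cons.mp hW).elim (fun h => Rows.rung_401604b1 hGZK W h) fun hW => ?_  -- 401604b1
  refine (List.mem_cons.mp hW).elim (fun h => Rows.rung_423030c1 hGZK W h) fun hW => ?_  -- 423030c1
  refine (List.mem_cons.mp hW).elim (fun h => Rows.rung_225654j1 hGZK W h) fun hW => ?_  -- 225654j1
  refine (List.mem_cons.mp hW).elim (fun h => Rows.rung_240240bf1 hGZK W h) fun hW => ?_  -- 240240bf1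
  refine (List.mem_cons.mp hW).elim (fun h => Rows.rung_393420c1 hGZK W h) fun hW => ?_  -- 393420c1
  refine (List.mem_cons.mp hW).elim (fun h => Rows.rung_428730d1 hGZK W h) fun hW => ?_  -- 428730d1
  refine (List.mem_cons.mp hW).elim (fun h => Rows.rung_365442ba1 hGZK W h) fun hW => ?_  -- 365442ba1
  refine (List.mem_cons.mp hW).elim (fun h => Rows.rung_457314bm1 hGZK W h) fun hW => ?_  -- 457314bm1
  refine (List.mem_cons.mp hW).elim (fun h => Rows.rung_240834d1 hGZK W h) fun hW => ?_  -- 240834d1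
  refine (List.mem_cons.mp hW).elim (fun h => Rows.rung_494130bk1 hGZK W h) fun hW => ?_  -- 494130bk1
  refine (List.mem_cons.mp hW).elim (fun h => Rows.rung_300300o1 hGZK W h) fun hW => ?_  -- 300300o1
  refine (List.mem_cons.mp hW).elim (fun h => Rows.rung_352410k1 hGZK W h) fun hW => ?_  -- 352410k1
  refine (List.mem_cons.mp hW).elim (fun h => Rows.rung_381840h1 hGZK W h) fun hW => ?_  -- 381840h1
  refine (List.mem_cons.mp hW).elim (fun h => Rows.rung_282948d1 hGZK W h) fun hW => ?_  -- 282948d1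
  refine (List.mem_cons.mp hW).elim (fun h => Rows.rung_420060b1 hGZK W h) fun hW => ?_  -- 420060b1
  refine (List.mem_cons.mp hW).elim (fun h => Rows.rung_388542f1 hGZK W h) fun hW => ?_  -- 388542f1
  refine (List.mem_cons.mp hW).elim (fun h => Rows.rung_388740f1 hGZK W h) fun hW => ?_  -- 388740f1
  refine (List.mem_cons.mp hW).elim (fun h => Rows.rung_493350eb1 hGZK W h) fun hW => ?_  -- 493350eb1
  refine (List.mem_cons.mp hW).elim (fun h => Rows.rung_485310m1 hGZK W h) fun hW => ?_  -- 485310m1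
  refine (List.mem_cons.mp hW).elim (fun h => Rows.rung_475734l1 hGZK W h) fun hW => ?_  -- 475734l1
  refine (List.mem_cons.mp hW).elim (fun h => Rows.rung_291270h1 hGZK W h) fun hW => ?_  -- 291270h1
  refine (List.mem_cons.mp hW).elim (fun h => Rows.rung_381270g1 hGZK W h) fun hW => ?_  -- 381270g1
  refine (List.mem_cons.mp hW).elim (fun h => Rows.rung_494130bm1 hGZK W h) fun hW => ?_  -- 494130bm1
  refine (List.mem_cons.mp hW).elim (fun h => Rows.rung_340170i1 hGZK W h) fun hW => ?_  -- 340170i1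
  refine (List.mem_cons.mp hW).elim (fun h => Rows.rung_235524a1 hGZK W h) fun hW => ?_  -- 235524a1
  refine (List.mem_cons.mp hW).elim (fun h => Rows.rung_318828a1 hGZK W h) fun hW => ?_  -- 318828a1
  refine (List.mem_cons.mp hW).elim (fun h => Rows.rung_335244h1 hGZK W h) fun hW => ?_  -- 335244h1
  refine (List.mem_cons.mp hW).elim (fun h => Rows.rung_437100a1 hGZK W h) fun hW => ?_  -- 437100a1
  refine (List.mem_cons.mp hW).elim (fun h => Rows.rung_178980a1 hGZK W h) fun hW => ?_  -- 178980a1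
  refine (List.mem_cons.mp hW).elim (fun h => Rows.rung_438150bm1 hGZK W h) fun hW => ?_  -- 438150bm1
  refine (List.mem_cons.mp hW).elim (fun h => Rows.rung_457950bk1 hGZK W h) fun hW => ?_  -- 457950bk1
  refine (List.mem_cons.mp hW).elim (fun h => Rows.rung_478950ba1 hGZK W h) fun hW => ?_  -- 478950ba1
  refine (List.mem_cons.mp hW).elim (fun h => Rows.rung_329640h1 hGZK W h) fun hW => ?_  -- 329640h1
  refine (List.mem_cons.mp hW).elim (fun h => Rows.rung_423150m1 hGZK W h) fun hW => ?_  -- 423150m1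
  refine (List.mem_cons.mp hW).elim (fun h => Rows.rung_311100b1 hGZK W h) fun hW => ?_  -- 311100b1
  refine (List.mem_cons.mp hW).elim (fun h => Rows.rung_423570d1 hGZK W h) fun hW => ?_  -- 423570d1
  refine (List.mem_cons.mp hW).elim (fun h => Rows.rung_200460e1 hGZK W h) fun hW => ?_  -- 200460e1
  refine (List.mem_cons.mp hW).elim (fun h => Rows.rung_498030m1 hGZK W h) fun hW => ?_  -- 498030m1
  refine (List.mem_cons.mp hW).elim (fun h => Rows.rung_438960ba1 hGZK W h) fun hW => ?_  -- 438960ba1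
  refine (List.mem_cons.mp hW).elim (fun h => Rows.rung_418470bb1 hGZK W h) fun hW => ?_  -- 418470bb1
  refine (List.mem_cons.mp hW).elim (fun h => Rows.rung_458850bb1 hGZK W h) fun hW => ?_  -- 458850bb1
  refine (List.mem_cons.mp hW).elim (fun h => Rows.rung_393900c1 hGZK W h) fun hW => ?_  -- 393900c1
  refine (List.mem_cons.mp hW).elim (fun h => Rows.rung_266370c1 hGZK W h) fun hW => ?_  -- 266370c1
  refine (List.mem_cons.mp hW).elim (fun h => Rows.rung_309738bi1 hGZK W h) fun hW => ?_  -- 309738bi1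
  refine (List.mem_cons.mp hW).elim (fun h => Rows.rung_439698ci1 hGZK W h) fun hW => ?_  -- 439698ci1
  refine (List.mem_cons.mp hW).elim (fun h => Rows.rung_368430f1 hGZK W h) fun hW => ?_  -- 368430f1
  refine (List.mem_cons.mp hW).elim (fun h => Rows.rung_349350bc1 hGZK W h) fun hW => ?_  -- 349350bc1
  refine (List.mem_cons.mp hW).elim (fun h => Rows.rung_415140e1 hGZK W h) fun hW => ?_  -- 415140e1
  refine (List.mem_cons.mp hW).elim (fun h => Rows.rung_487578bi1 hGZK W h) fun hW => ?_  -- 487578bi1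
  refine (List.mem_cons.mp hW).elim (fun h => Rows.rung_199290bh1 hGZK W h) fun hW => ?_  -- 199290bh1
  refine (List.mem_cons.mp hW).elim (fun h => Rows.rung_393414bo1 hGZK W h) fun hW => ?_  -- 393414bo1
  refine (List.mem_cons.mp hW).elim (fun h => Rows.rung_489426i1 hGZK W h) fun hW => ?_  -- 489426i1
  refine (List.mem_cons.mp hW).elim (fun h => Rows.rung_322140b1 hGZK W h) fun hW => ?_  -- 322140b1
  refine (List.mem_cons.mp hW).elim (fun h => Rows.rung_275100g1 hGZK W h) fun hW => ?_  -- 275100g1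
  refine (List.mem_cons.mp hW).elim (fun h => Rows.rung_409146e1 hGZK W h) fun hW => ?_  -- 409146e1
  refine (List.mem_cons.mp hW).elim (fun h => Rows.rung_418470bd1 hGZK W h) fun hW => ?_  -- 418470bd1
  refine (List.mem_cons.mp hW).elim (fun h => Rows.rung_309738bq1 hGZK W h) fun hW => ?_  -- 309738bq1
  refine (List.mem_cons.mp hW).elim (fun h => Rows.rung_249690bk1 hGZK W h) fun hW => ?_  -- 249690bk1
  refine (List.mem_cons.mp hW).elim (fun h => Rows.rung_289380e1 hGZK W h) fun hW => ?_  -- 289380e1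
  refine (List.mem_cons.mp hW).elim (fun h => Rows.rung_459690bc1 hGZK W h) fun hW => ?_  -- 459690bc1
  refine (List.mem_cons.mp hW).elim (fun h => Rows.rung_478950bu1 hGZK W h) fun hW => ?_  -- 478950bu1
  refine (List.mem_cons.mp hW).elim (fun h => Rows.rung_422382c1 hGZK W h) fun hW => ?_  -- 422382c1
  refine (List.mem_cons.mp hW).elim (fun h => Rows.rung_480270bc1 hGZK W h) fun hW => ?_  -- 480270bc1
  refine (List.mem_cons.mp hW).elim (fun h => Rows.rung_393414bu1 hGZK W h) fun hW => ?_  -- 393414bu1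
  refine (List.mem_cons.mp hW).elim (fun h => Rows.rung_263670bh1 hGZK W h) fun hW => ?_  -- 263670bh1
  refine (List.mem_cons.mp hW).elim (fun h => Rows.rung_343200b1 hGZK W h) fun hW => ?_  -- 343200b1
  refine (List.mem_cons.mp hW).elim (fun h => Rows.rung_419430c1 hGZK W h) fun hW => ?_  -- 419430c1
  refine (List.mem_cons.mp hW).elim (fun h => Rows.rung_363660d1 hGZK W h) fun hW => ?_  -- 363660d1
  refine (List.mem_cons.mp hW).elim (fun h => Rows.rung_259350c1 hGZK W h) fun hW => ?_  -- 259350c1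
  refine (List.mem_cons.mp hW).elim (fun h => Rows.rung_390390bb1 hGZK W h) fun hW => ?_  -- 390390bb1
  refine (List.mem_cons.mp hW).elim (fun h => Rows.rung_344694y1 hGZK W h) fun hW => ?_  -- 344694y1
  refine (List.mem_cons.mp hW).elim (fun h => Rows.rung_287742cj1 hGZK W h) fun hW => ?_  -- 287742cj1
  refine (List.mem_cons.mp hW).elim (fun h => Rows.rung_194298p1 hGZK W h) fun hW => ?_  -- 194298p1
  refine (List.mem_cons.mp hW).elim (fun h => Rows.rung_468174f1 hGZK W h) fun hW => ?_  -- 468174f1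
  refine (List.mem_cons.mp hW).elim (fun h => Rows.rung_283290bw1 hGZK W h) fun hW => ?_  -- 283290bw1
  refine (List.mem_cons.mp hW).elim (fun h => Rows.rung_417444e1 hGZK W h) fun hW => ?_  -- 417444e1
  refine (List.mem_cons.mp hW).elim (fun h => Rows.rung_183540t1 hGZK W h) fun hW => ?_  -- 183540t1
  refine (List.mem_cons.mp hW).elim (fun h => Rows.rung_385140o1 hGZK W h) fun hW => ?_  -- 385140o1
  refine (List.mem_cons.mp hW).elim (fun h => Rows.rung_135894bc1 hGZK W h) fun hW => ?_  -- 135894bc1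
  refine (List.mem_cons.mp hW).elim (fun h => Rows.rung_386610d1 hGZK W h) fun hW => ?_  -- 386610d1
  refine (List.mem_cons.mp hW).elim (fun h => Rows.rung_406560h1 hGZK W h) fun hW => ?_  -- 406560h1
  refine (List.mem_cons.mp hW).elim (fun h => Rows.rung_255360z1 hGZK W h) fun hW => ?_  -- 255360z1
  refine (List.mem_cons.mp hW).elim (fun h => Rows.rung_428610p1 hGZK W h) fun hW => ?_  -- 428610p1
  refine (List.mem_cons.mp hW).elim (fun h => Rows.rung_458490be1 hGZK W h) fun hW => ?_  -- 458490be1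
  refine (List.mem_cons.mp hW).elim (fun h => Rows.rung_471417f1 hGZK W h) fun hW => ?_  -- 471417f1
  refine (List.mem_cons.mp hW).elim (fun h => Rows.rung_104910b1 hGZK W h) fun hW => ?_  -- 104910b1
  refine (List.mem_cons.mp hW).elim (fun h => Rows.rung_157530n1 hGZK W h) fun hW => ?_  -- 157530n1
  refine (List.mem_cons.mp hW).elim (fun h => Rows.rung_177072bb1 hGZK W h) fun hW => ?_  -- 177072bb1
  refine (List.mem_cons.mp hW).elim (fun h => Rows.rung_219450gp1 hGZK W h) fun hW => ?_  -- 219450gp1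
  refine (List.mem_cons.mp hW).elim (fun h => Rows.rung_263670bv1 hGZK W h) fun hW => ?_  -- 263670bv1
  refine (List.mem_cons.mp hW).elim (fun h => Rows.rung_339150e1 hGZK W h) fun hW => ?_  -- 339150e1
  refine (List.mem_cons.mp hW).elim (fun h => Rows.rung_210270j1 hGZK W h) fun hW => ?_  -- 210270j1
  refine (List.mem_cons.mp hW).elim (fun h => Rows.rung_224112ci1 hGZK W h) fun hW => ?_  -- 224112ci1
  refine (List.mem_cons.mp hW).elim (fun h => Rows.rung_241230d1 hGZK W h) fun hW => ?_  -- 241230d1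
  refine (List.mem_cons.mp hW).elim (fun h => Rows.rung_309120m1 hGZK W h) fun hW => ?_  -- 309120m1
  refine (List.mem_cons.mp hW).elim (fun h => Rows.rung_341880i1 hGZK W h) fun hW => ?_  -- 341880i1
  refine (List.mem_cons.mp hW).elim (fun h => Rows.rung_381045j1 hGZK W h) fun hW => ?_  -- 381045j1
  refine (List.mem_cons.mp hW).elim (fun h => Rows.rung_425040dj1 hGZK W h) fun hW => ?_  -- 425040dj1
  refine (List.mem_cons.mp hW).elim (fun h => Rows.rung_430998b1 hGZK W h) fun hW => ?_  -- 430998b1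
  refine (List.mem_cons.mp hW).elim (fun h => Rows.rung_70242a1 hGZK W h) fun hW => ?_  -- 70242a1
  refine (List.mem_cons.mp hW).elim (fun h => Rows.rung_227766p1 hGZK W h) fun hW => ?_  -- 227766p1
  refine (List.mem_cons.mp hW).elim (fun h => Rows.rung_262200bb1 hGZK W h) fun hW => ?_  -- 262200bb1
  refine (List.mem_cons.mp hW).elim (fun h => Rows.rung_269382c1 hGZK W h) fun hW => ?_  -- 269382c1
  refine (List.mem_cons.mp hW).elim (fun h => Rows.rung_362670a1 hGZK W h) fun hW => ?_  -- 362670a1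
  refine (List.mem_cons.mp hW).elim (fun h => Rows.rung_424074i1 hGZK W h) fun hW => ?_  -- 424074i1
  refine (List.mem_cons.mp hW).elim (fun h => Rows.rung_427056a1 hGZK W h) fun hW => ?_  -- 427056a1
  exact nomatch hW

end Summit.BirchSwinnertonDyer.Rank1Residual.X11b.RegMult.Reg3Cert
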